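import Mathlib
import Literature.Analysis.FluidPDE.TypeIAncientMild
import Literature.Analysis.FluidPDE.SelfSimilar
import Summits.NavierStokesRegularity.NavierStokesRegularity.Theses.SymmetryModuliCount
import Summits.NavierStokesRegularity.NavierStokesRegularity.Theorems.ScenarioCensusScrewBlowdownVanishing
import Summits.NavierStokesRegularity.NavierStokesRegularity.Theorems.ClockStretchingLawClockCeilingGermRigidity
import Summits.NavierStokesRegularity.NavierStokesRegularity.Theorems.ExtremiserTransienceNearExtremalTransiencePerFlowAxisymmetricTypeILiouville
import Summits.NavierStokesRegularity.NavierStokesRegularity.Theorems.TypeIQuarterGateScarEnvelopeTypeINearOneRateDss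
import HarnessLib
import Summits.NavierStokesRegularity.NavierStokesRegularity.Theorems.ScenarioCensusSilenceMeterRows

/-!
# Block A2, instrument AGEING METER (ns-idea-2 LINE g17-2 REV 3; cells A2agT / A2agV / A2ag0 / A2agU / A2agFf / A2ag2v DECIDED, A2agF OPEN ≡ D7) — port, part 1/5: §A the instrument (the
# receding similarity ball — SILENCE METER's `simBall` BY NAME —, the ageing reading, recurrence); §B exact laws (a germ recurring modulo a co-motion, or about an interior vertex, kills
# the element); §C one-limit Liouville (from S3)

Re-homed for the scenario census (typer seat ns-census-typer-1 g10; the cells A2agT / A2agV / A2ag0 / A2agU / A2agFf / A2ag2v are MEMBERS OF RECORD «DECIDED IN KERNEL IN FILES» of row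
A2 (item 77: REV 1 critic PASS tier B, REV 3 idea-crit-3 g10 ROW WORDS BY KEY 11:55:14Z; ref PRE-CHECK ✓ §18.27 / §18.37; lead label), A2agF OPEN ≡ D7; this port makes the decided
cells TREE-decided): VERBATIM PORT of ns-idea-2 LINE g17-2 «ageing-meter» REV 3, `pub/ideators/ns-idea-2/lines/ageing-meter/line-ageing-meter.rev3.lean` sha16 a9c9c668d639c4c6
(1173 l., lean check rc 0, 0 sorry), split for the 400-line rule into `ScenarioCensusAgeingMeter` (§A–§C) → `…AgeingMeterLaw` (§D–§E) → `…AgeingMeterRows` (§F–§G) →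
`…AgeingMeterVertex` (§F′) → `…AgeingMeterTwoVertex` (§F″, §H + census KEYS).  Lean text VERBATIM in namespace `…Theorems.ScenarioCensus.AgeingMeter` (the line's
`…Lines.AgeingMeter` re-homed); port edits: the line's `local notation "E3"` is spelled as the reducible `abbrev E3` of every census file; declarations the line restates VERBATIM
from the landed SILENCE METER (`simBall`, `simBall_neg_one`, `smul_mem_simBall`, `e₀`, `norm_e₀`) and HULL METER (`pastPart`, `pastPart_of_neg`, `pastPart_of_not_neg`,
`isTypeIAncientMild_pastPart`, `isDiscretelySelfSimilar_pastPart`, `PastInvariant`, `PastLiouville`) ports are taken BY NAME (gate lint dedup.landed); `set_option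
linter.unusedVariables false` dropped (binders the linter names are `_`-prefixed); `@[conjecture]` on the OPEN row `Row_A2agF` (≡ census D7); one-line docstrings added where missing
(gate lint).  Statements untouched.

No census VALUE is moved here (row A2 stays OPEN-WITH-LINE; the members become TREE-decided by name); D7 / (L′) are NOT proved; no summit statement is proved by this file. Lemmas that restate already-landed tree declarations are taken BY NAME (gate lint `dedup.landed`): `simBall` = `SilenceMeter.simBall`, `smul_mem_simBall` = `SilenceMeter.smul_mem_simBall`, `e₀` = `SilenceMeter.e₀`, `pastPart` = `HullMeter.pastPart`, `isTypeIAncientMild_pastPart` = `HullMeter.isTypeIAncientMild_pastPart`, `isDiscretelySelfSimilar_pastPart` = `HullMeter.isDiscretelySelfSimilar_pastPart`, `PastInvariant` = `HullMeter.PastInvariant`, `PastLiouville` = `HullMeter.PastLiouville`.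
-/

-- the summit and its single problem share the name `NavierStokesRegularity` (D-0017 nested layout)
set_option linter.dupNamespace false

noncomputable section

open Set Function Filter Metric
open scoped Topology
open Literature.Analysis Literature.Analysis.FluidPDE
open Summit.NavierStokesRegularity.NavierStokesRegularity.Theorems
open Summit.NavierStokesRegularity.NavierStokesRegularity.Theorems.ScenarioCensus.ScrewBlowdown
open Summit.NavierStokesRegularity.NavierStokesRegularity.Theorems.NearExtremalTransiencePerFlow.FilamentSelection
open Summit.NavierStokesRegularity.NavierStokesRegularity.Cruxes.ScarEnvelopeTypeI.AxisActivity

namespace Summit.NavierStokesRegularity.NavierStokesRegularity.Theorems.ScenarioCensus.AgeingMeter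

/-- `ℝ³` (the line's `local notation "E3"`, spelled as a reducible abbreviation for the tree). -/
abbrev E3 := EuclideanSpace ℝ (Fin 3)

variable {C : ℝ} {u : ℝ → E3 → E3}

/-! ## A. The instrument -/

-- `simBall`: the line restates the tree's `SilenceMeter.simBall`; taken BY NAME (gate lint dedup.landed).

/-- The AGEING READING of `u` at time `s` and place `z`, lag `δ`, co-motion `(L, b)`: the scale-invariant size of
`u((1+δ)s, L z + √(−s) b) − L u(s, z)`. -/
def reading (L : E3 ≃ₗᵢ[ℝ] E3) (b : E3) (δ : ℝ) (u : ℝ → E3 → E3) (s : ℝ) (z : E3) : ℝ :=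
  Real.sqrt (-s) * ‖u ((1 + δ) * s) (L z + Real.sqrt (-s) • b) - L (u s z)‖

/-- `u` RECURS ASYMPTOTICALLY (lag `δ`, co-motion `(L, b)`) on the similarity ball `B̄(η₀, ρ)` along the times
`s k → −∞`: all readings on `√(−s k)·B̄(η₀, ρ)` are below `ε k → 0`. -/
def RecursAlong (u : ℝ → E3 → E3) (L : E3 ≃ₗᵢ[ℝ] E3) (b : E3) (δ : ℝ) (η₀ : E3) (ρ : ℝ) (s : ℕ → ℝ) : Prop :=
  (∀ k, s k < 0) ∧ Tendsto s atTop atBot ∧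
    ∃ ε : ℕ → ℝ, Tendsto ε atTop (𝓝 0) ∧ ∀ k, ∀ z ∈ SilenceMeter.simBall η₀ ρ (s k), reading L b δ u (s k) z ≤ ε k

/-- `u` has the AGEING FLOOR `f` (lag `δ`, co-motion `(L, b)`) on `B̄(η₀, ρ)`: at EVERY time before some `T < 0`
some reading on `√(−s)·B̄(η₀, ρ)` exceeds `f`. -/
def HasAgeingFloor (u : ℝ → E3 → E3) (L : E3 ≃ₗᵢ[ℝ] E3) (b : E3) (δ : ℝ) (η₀ : E3) (ρ f : ℝ) : Prop :=
  ∃ T < (0 : ℝ), ∀ s < T, ∃ z ∈ SilenceMeter.simBall η₀ ρ s, f < reading L b δ u s z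

/-- The ageing reading is non-negative. -/
theorem reading_nonneg (L : E3 ≃ₗᵢ[ℝ] E3) (b : E3) (δ : ℝ) (u : ℝ → E3 → E3) (s : ℝ) (z : E3) :
    0 ≤ reading L b δ u s z :=
  mul_nonneg (Real.sqrt_nonneg _) (norm_nonneg _)

/-- At time `−1` the reading is the plain defect `‖u(−1−δ, L x + b) − L u(−1, x)‖`. -/
theorem reading_neg_one (L : E3 ≃ₗᵢ[ℝ] E3) (b : E3) (δ : ℝ) (u : ℝ → E3 → E3) (x : E3) :
    reading L b δ u (-1) x = ‖u (-1 - δ) (L x + b) - L (u (-1) x)‖ := by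
  simp only [reading, neg_neg, Real.sqrt_one, one_mul, one_smul]
  congr 3
  ring

-- `smul_mem_simBall`: the line restates the tree's `SilenceMeter.smul_mem_simBall`; taken BY NAME (gate lint dedup.landed).

/-- THE METER READS ZOOMS: the reading of the `μ`-zoom at `(t, x)` is the reading of `u` at `(μ² t, μ x)` (the
co-motion's translation part scales parabolically, which is why the instrument carries `√(−s) b`). -/
theorem reading_nsRescale (L : E3 ≃ₗᵢ[ℝ] E3) (b : E3) (δ : ℝ) {μ t : ℝ} (hμ : 0 < μ) (x : E3) :
    reading L b δ (nsRescale μ u) t x = reading L b δ u (μ ^ 2 * t) (μ • x) := by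
  have hsq : Real.sqrt (-(μ ^ 2 * t)) = μ * Real.sqrt (-t) := by
    rw [show -(μ ^ 2 * t) = μ ^ 2 * (-t) by ring, Real.sqrt_mul (sq_nonneg _), Real.sqrt_sq hμ.le]
  have h1 : μ • (L x + Real.sqrt (-t) • b) = L (μ • x) + Real.sqrt (-(μ ^ 2 * t)) • b := by
    rw [hsq, smul_add, smul_smul, L.map_smul]
  have h2 : μ ^ 2 * ((1 + δ) * t) = (1 + δ) * (μ ^ 2 * t) := by ring
  simp only [reading, nsRescale]
  rw [h2, h1, L.map_smul μ (u (μ ^ 2 * t) (μ • x)), ← smul_sub, norm_smul, Real.norm_eq_abs, abs_of_pos hμ,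
    hsq]
  ring

/-! ## B. Exact laws: a germ that recurs modulo a co-motion, or about an interior vertex, kills the element -/

/-- Iterated Type-I decay: `‖u t x‖ ≤ C/√(nδ − t)` for all `n` forces `u t x = 0`. -/
theorem eq_zero_of_forall_le_sqrt (hC : 0 ≤ C) {δ : ℝ} (hδ : 0 < δ) {t : ℝ} (ht : t < 0) {x : E3}
    (h : ∀ n : ℕ, ‖u t x‖ ≤ C / Real.sqrt (n * δ - t)) : u t x = 0 := by
  by_contra hx
  have ha : 0 < ‖u t x‖ := norm_pos_iff.2 hx
  obtain ⟨n, hn⟩ := exists_nat_gt ((C / ‖u t x‖) ^ 2 / δ)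
  have hR : (C / ‖u t x‖) ^ 2 < n * δ - t := by
    have h1 : (C / ‖u t x‖) ^ 2 < n * δ := (div_lt_iff₀ hδ).1 hn
    linarith
  have hsqrt : C / ‖u t x‖ < Real.sqrt (n * δ - t) := by
    rw [show C / ‖u t x‖ = Real.sqrt ((C / ‖u t x‖) ^ 2) from (Real.sqrt_sq (div_nonneg hC ha.le)).symm]
    exact Real.sqrt_lt_sqrt (sq_nonneg _) hR
  have hRpos : 0 < Real.sqrt (n * δ - t) := lt_of_le_of_lt (div_nonneg hC ha.le) hsqrt
  have h1 : ‖u t x‖ * Real.sqrt (n * δ - t) ≤ C := (le_div_iff₀ hRpos).1 (h n)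
  have h2 : C < ‖u t x‖ * Real.sqrt (n * δ - t) := by
    have h3 := mul_lt_mul_of_pos_left hsqrt ha
    rwa [mul_div_assoc', mul_div_cancel_left₀ C ha.ne'] at h3
  linarith

/-- **EXACT DRIFT LAW** (PROVED): a germ of ONE slice that recurs after a lag `δ > 0` modulo a rigid co-motion —
`L⁻¹ u(t₀ − δ, L x + b) = u(t₀, x)` on a nonempty open `U` — forces `u ≡ 0` on `t < 0`.  The co-moved aged copy
`(t, x) ↦ L⁻¹ u(t − δ, L x + b)` is a class element (`isTypeIAncientMild_conj_affine`, `comp_sub_right`), so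
`germRigidity` makes the recurrence global; then `‖u(t, x)‖ = ‖u(t − δ, L x + b)‖ = … ≤ C/√(nδ − t) → 0`.
The case `L = 1, b = 0` is the tree's `eq_zero_of_germ_timeRecurrent`. -/
theorem eq_zero_of_comotionRecurrent (hu : IsTypeIAncientMild C u) (L : E3 ≃ₗᵢ[ℝ] E3) (b : E3) {δ : ℝ}
    (hδ : 0 < δ) {t₀ : ℝ} (ht₀ : t₀ < 0) {U : Set E3} (hU : IsOpen U) (hne : U.Nonempty)
    (heq : ∀ x ∈ U, L.symm (u (t₀ - δ) (L x + b)) = u t₀ x) : ∀ t < 0, ∀ x, u t x = 0 := by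
  have hv : IsTypeIAncientMild C (fun t x => L.symm (u (t - δ) (L x + b))) :=
    isTypeIAncientMild_conj_affine (hu.comp_sub_right hδ.le) L b
  have hglob : ∀ t < 0, ∀ x, L.symm (u (t - δ) (L x + b)) = u t x := fun t ht x =>
    germRigidity hv hu ht₀ hU hne heq ht x
  have hiter : ∀ n : ℕ, ∀ t < 0, ∀ x, ‖u t x‖ ≤ C / Real.sqrt (n * δ - t) := by
    intro n
    induction n with
    | zero =>
      intro t ht x
      simpa using hu.norm_le ht x
    | succ n ih =>
      intro t ht x
      rw [← hglob t ht x, LinearIsometryEquiv.norm_map]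
      have h := ih (t - δ) (by linarith) (L x + b)
      have e : (n : ℝ) * δ - (t - δ) = ((n + 1 : ℕ) : ℝ) * δ - t := by
        push_cast
        ring
      rwa [e] at h
  intro t ht x
  exact eq_zero_of_forall_le_sqrt hu.nonneg hδ ht fun n => hiter n t ht x

/-- The vertex of the time-action `t ↦ λ²(t − δ)`. -/
def vertex (l δ : ℝ) : ℝ := l ^ 2 * δ / (l ^ 2 - 1)

/-- The vertex time is negative (fine factor side). -/
theorem vertex_neg {l δ : ℝ} (hl : 0 < l) (hl1 : l < 1) (hδ : 0 < δ) : vertex l δ < 0 := by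
  have h1 : l ^ 2 - 1 < 0 := by nlinarith
  exact div_neg_of_pos_of_neg (by positivity) h1

/-- The vertex time is positive (coarse factor side). -/
theorem vertex_pos {l δ : ℝ} (hl1 : 1 < l) (hδ : 0 < δ) : 0 < vertex l δ := by
  have h1 : 0 < l ^ 2 - 1 := by nlinarith
  exact div_pos (by positivity) h1

/-- The key identity of the time-action: `λ²(t − δ) − t_T = λ²(t − t_T)`. -/
theorem vertex_step {l δ : ℝ} (hl : l ^ 2 ≠ 1) (t : ℝ) :
    l ^ 2 * (t - δ) = vertex l δ + l ^ 2 * (t - vertex l δ) := by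
  have h : l ^ 2 - 1 ≠ 0 := sub_ne_zero.2 hl
  unfold vertex
  field_simp
  ring

/-- **EXACT INTERIOR-VERTEX LAW** (PROVED): a germ of ONE slice that recurs under the parabolic scaling with
factor `0 < λ < 1` composed with a lag `δ > 0` — `λ u(λ²(t₀ − δ), λx) = u(t₀, x)` on a nonempty open `U` —
forces `u ≡ 0` on `t < 0`: the recurrence is global (`germRigidity` against the zoom of the aged copy,
`zoom_isTypeIAncientMild`), its vertex `t_T = λ²δ/(λ² − 1) < 0` is interior, and
`u(t, x) = λⁿ u(t_T + λ²ⁿ(t − t_T), λⁿ x) → 0` by continuity of `u` on the open past. -/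
theorem eq_zero_of_interiorVertexRecurrent (hu : IsTypeIAncientMild C u) {l δ : ℝ} (hl : 0 < l) (hl1 : l < 1)
    (hδ : 0 < δ) {t₀ : ℝ} (ht₀ : t₀ < 0) {U : Set E3} (hU : IsOpen U) (hne : U.Nonempty)
    (heq : ∀ x ∈ U, l • u (l ^ 2 * (t₀ - δ)) (l • x) = u t₀ x) : ∀ t < 0, ∀ x, u t x = 0 := by
  -- the zoom of the aged copy is a class element
  have hv : IsTypeIAncientMild C (nsRescale l (fun s => u (s - l ^ 2 * δ))) :=
    zoom_isTypeIAncientMild (hu.comp_sub_right (by positivity)) hl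
  have hv' : ∀ t x, nsRescale l (fun s => u (s - l ^ 2 * δ)) t x = l • u (l ^ 2 * (t - δ)) (l • x) := by
    intro t x
    show l • u (l ^ 2 * t - l ^ 2 * δ) (l • x) = _
    rw [show l ^ 2 * t - l ^ 2 * δ = l ^ 2 * (t - δ) by ring]
  have hglob : ∀ t < 0, ∀ x, l • u (l ^ 2 * (t - δ)) (l • x) = u t x := by
    intro t ht x
    rw [← hv']
    exact germRigidity hv hu ht₀ hU hne (fun y hy => by rw [hv']; exact heq y hy) ht x
  -- the vertex
  set T : ℝ := vertex l δ with hTdef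
  have hT : T < 0 := vertex_neg hl hl1 hδ
  have hl2 : l ^ 2 ≠ 1 := by nlinarith
  have hl2' : l ^ 2 < 1 := by nlinarith
  -- iteration into the vertex
  have hiter : ∀ n : ℕ, ∀ t < 0, ∀ x, u t x = l ^ n • u (T + (l ^ 2) ^ n * (t - T)) (l ^ n • x) := by
    intro n
    induction n with
    | zero =>
      intro t ht x
      simp
    | succ n ih =>
      intro t ht x
      have ht' : l ^ 2 * (t - δ) < 0 := mul_neg_of_pos_of_neg (by positivity) (by linarith)
      rw [← hglob t ht x, ih _ ht' (l • x), smul_smul, smul_smul, ← pow_succ', ← pow_succ,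
        vertex_step hl2 t, ← hTdef]
      congr 2
      ring
  -- `u` is bounded near the interior vertex `(T, 0)`
  set K : Set (ℝ × E3) := Icc (T - 1) (T / 2) ×ˢ Metric.closedBall (0 : E3) 1 with hKdef
  have hKc : IsCompact K := isCompact_Icc.prod (isCompact_closedBall _ _)
  have hKsub : K ⊆ Iio (0 : ℝ) ×ˢ (univ : Set E3) := by
    rintro ⟨s, y⟩ ⟨hs, -⟩
    exact ⟨show s < 0 by have := hs.2; simp only at this; linarith, mem_univ _⟩
  obtain ⟨M, hM⟩ := hKc.exists_bound_of_continuousOn (hu.continuousOn_uncurry.mono hKsub)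
  -- the orbit enters the compact neighbourhood and the prefactor `λⁿ` tends to `0`
  intro t ht x
  have hpow : Tendsto (fun n : ℕ => (l ^ 2) ^ n) atTop (𝓝 0) :=
    tendsto_pow_atTop_nhds_zero_of_lt_one (by positivity) hl2'
  have hpow1 : Tendsto (fun n : ℕ => l ^ n) atTop (𝓝 0) :=
    tendsto_pow_atTop_nhds_zero_of_lt_one hl.le hl1
  have htn : Tendsto (fun n : ℕ => T + (l ^ 2) ^ n * (t - T)) atTop (𝓝 T) := by
    have h := tendsto_const_nhds (x := T).add (hpow.mul_const (t - T))
    simpa using h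
  have hxn : Tendsto (fun n : ℕ => l ^ n • x) atTop (𝓝 0) := by
    simpa using hpow1.smul_const x
  have hev1 : ∀ᶠ n : ℕ in atTop, T + (l ^ 2) ^ n * (t - T) ∈ Icc (T - 1) (T / 2) :=
    htn (Icc_mem_nhds (by linarith) (by linarith))
  have hev2 : ∀ᶠ n : ℕ in atTop, l ^ n • x ∈ Metric.closedBall (0 : E3) 1 :=
    hxn (Metric.closedBall_mem_nhds _ one_pos)
  have hev : ∀ᶠ n : ℕ in atTop, ‖u t x‖ ≤ l ^ n * M := by
    filter_upwards [hev1, hev2] with n hn1 hn2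
    have hb := hM (T + (l ^ 2) ^ n * (t - T), l ^ n • x) ⟨hn1, hn2⟩
    rw [hiter n t ht x, norm_smul, Real.norm_eq_abs, abs_of_pos (pow_pos hl n)]
    exact mul_le_mul_of_nonneg_left hb (pow_pos hl n).le
  have hlim : Tendsto (fun n : ℕ => l ^ n * M) atTop (𝓝 0) := by
    simpa using hpow1.mul_const M
  have h0 : ‖u t x‖ ≤ 0 := ge_of_tendsto hlim hev
  exact norm_le_zero_iff.1 h0

/-! ## C. One-limit Liouville (from S3) -/

/-- **ONE-LIMIT LIOUVILLE** (PROVED; corollary of the tree's `ScrewBlowdown.substantial_at_large_scales`): a class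
element with ONE identically vanishing blow-down limit vanishes. -/
theorem eq_zero_of_blowdownLimit_zero (hu : IsTypeIAncientMild C u) {W : ℝ → E3 → E3}
    (hW : IsBlowdownLimit C u W) (h0 : ∀ t < 0, ∀ x, W t x = 0) :
    ∀ t < 0, ∀ x, u t x = 0 := by
  by_contra hne
  push Not at hne
  obtain ⟨t₀, ht₀, x₀, hx₀⟩ := hne
  obtain ⟨ε, hε, K, hK, hsub⟩ := substantial_at_large_scales C
  obtain ⟨μ₁, hμ₁, hloud⟩ := hsub u hu ⟨t₀, ht₀, x₀, hx₀⟩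
  obtain ⟨hWc, ν, hνpos, hνlim, hconv⟩ := hW
  have hK' : IsCompact (Metric.closedBall (0 : E3) K) := isCompact_closedBall _ _
  have hunif : TendstoUniformlyOn (fun j => nsRescale (ν j) u (-1)) (W (-1)) atTop
      (Metric.closedBall (0 : E3) K) :=
    (tendstoLocallyUniformlyOn_iff_tendstoUniformlyOn_of_compact hK').1
      ((hconv (-1) (by norm_num)).tendstoLocallyUniformlyOn)
  have hev := (Metric.tendstoUniformlyOn_iff.1 hunif) ε hε
  have hev2 : ∀ᶠ j in atTop, μ₁ ≤ ν j := hνlim.eventually_ge_atTop μ₁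
  obtain ⟨j, hj, hj2⟩ := (hev.and hev2).exists
  obtain ⟨y, hyK, hbig⟩ := hloud (ν j) hj2
  have hyj : y ∈ Metric.closedBall (0 : E3) K := by
    rw [Metric.mem_closedBall, dist_zero_right]; exact hyK
  have h1 := hj y hyj
  rw [h0 (-1) (by norm_num) y, dist_zero_left] at h1
  exact absurd h1 (not_lt.2 hbig.le)

end Summit.NavierStokesRegularity.NavierStokesRegularity.Theorems.ScenarioCensus.AgeingMeter

end
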